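import Summits.HodgeConjecture.HodgeConjecture.Theorems.RigidRelativesJacobianTorelliRelativesTateAlgebraicLeftInverse
import HarnessLib

/-!
# Crux `HodgeIsoForcesRelatives` (stmt-HodgeConjecture-18579), line `birth` — stub 1 `stub_nonzeroHodgeHomBijective`:
# A NON-ZERO HODGE HOMOMORPHISM BETWEEN RIGID-TYPE `Hⁿ`'S IS BIJECTIVE

Route `HodgeConjecture/RigidRelativesJacobianTorelli`, crux `HodgeIsoForcesRelatives` (rank 3, "period separation / Hodge ≤
Galois", iso face; the route's kill switch); registered skeleton `Cruxes/HodgeIsoForcesRelatives/Lines/birth.lean`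
(`HodgeIsoForcesRelatives_of : S₁ → S₂ → S₃ → the crux`: a non-zero Hodge hom of rigid-type `H³`'s is bijective (S₁), is a
MOTIVATED correspondence (S₂, the open heart), and bijective motivated correspondences preserving rational classes are
Galois-compatible on an open subgroup (S₃, André 1996 §2.5, XL)). This file closes S₁:

**Theorem** (`bijective_of_isHodgeHom_of_ne_zero`, every `n ≥ 1`). Let `X`, `X'` be smooth projective complex varieties of
dimension `n` of RIGID TYPE in degree `n` (`dim Hⁿ(–(ℂ); ℂ) = 2` with a non-zero class of type `(n, 0)`), and
`Φ : Hⁿ(X(ℂ); ℂ) → Hⁿ(X'(ℂ); ℂ)` a `ℂ`-linear map carrying rational classes to rational classes and `(n,0)`-classes to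
`(n,0)`-classes. If `Φ ≠ 0` then `Φ` is bijective.
Proof: `Hⁿ(X) = ℂ x₀ ⊕ ℂ conj x₀` with `x₀ ∈ H^{n,0}` (a class of two different types is zero, so `x₀`, `conj x₀` are
independent: `Theorems.RelativesTate.exists_types_of_finrank_eq_two`'s mechanism, here with coefficients), likewise
`Hⁿ(X') = ℂ x₀' ⊕ ℂ conj x₀'`. `Φ` commutes with conjugation (rational classes are real and span: `conjClass_linearMap`).
`Φ x₀` has type `(n,0)`, so `Φ x₀ = a x₀'`; then `Φ (conj x₀) = conj (Φ x₀) = conj(a) conj x₀'`; `Φ ≠ 0` forces `a ≠ 0`, and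
`Φ` carries the basis `(x₀, conj x₀)` to the basis `(a x₀', conj(a) conj x₀')`. (The `ℚ`-structure argument of the skeleton's
docstring — irreducibility of the rank-2 Hodge structure — is replaced by this direct basis computation; only the type
clause for `(p,q) = (n,0)` of `IsHodgeHom` is used.)

§3 gives the stub in the registered spelling (file-local notations `cx`, `Rigid`, `IsHodgeHom` for the skeleton's carriers;
nothing is defined) and §4 re-runs the skeleton's composition with S₁ discharged:
`hodgeIsoForcesRelatives_of_hodgeHomMotivated_of_motivatedGalois : S₂ → S₃ → Theses.RigidRelativesJacobianTorelli.HodgeIsoForcesRelatives`.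

HONEST STATUS. Nothing here is a case of the Hodge conjecture; the crux stays open (S₂ open problem, S₃ XL). No definition,
no named fact, no sorry.
References: [VoisinHodgeI2002] §7.1.1, Cor. 6.12, Cor. 6.14, Lemma 7.24; [GouveaYui2011] §1; [Andre1996Motifs] §2.1, §2.5;
[Deligne1982HodgeCycles] §2.
-/

noncomputable section

-- every declaration of this problem lives in `Summit.HodgeConjecture.HodgeConjecture.…` (summit = sub-problem)
set_option linter.dupNamespace false

open CategoryTheory AlgebraicGeometry MonoidalCategory
open Literature.AlgebraicTopology.SingularHomology
open Literature.AlgebraicGeometry.Motives Literature.AlgebraicGeometry.HodgeTheory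

namespace Summit.HodgeConjecture.HodgeConjecture.Theorems.HodgeIsoForcesRelatives

variable {n : ℕ} {X X' : SchemeOver ℂ}

/-! ## §1 Rigid-type `Hⁿ`: the basis `(x₀, conj x₀)` -/

/-- **`x₀` and `conj x₀` are linearly independent** for a non-zero class `x₀` of type `(n, 0)`, `n ≥ 1` (a class of the two
different types `(n,0)`, `(0,n)` is zero). [cite: VoisinHodgeI2002, Cor. 6.12 and Cor. 6.14] -/
theorem linearIndependent_pair_conjClass (hX : IsSmoothProjective n X) (hn : 0 < n) {x₀ : complexBetti X n}
    (hx₀0 : x₀ ≠ 0) (hx₀ : IsOfHodgeType n X n n 0 x₀) :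
    LinearIndependent ℂ ![x₀, conjClass (ComplexPoints X) n x₀] := by
  have hc₀ : IsOfHodgeType n X n 0 n (conjClass (ComplexPoints X) n x₀) := hx₀.conjClass hX
  refine LinearIndependent.pair_iff.2 fun a b hab ↦ ?_
  have ha : IsOfHodgeType n X n n 0 (a • x₀) := hx₀.smul a
  have ha' : IsOfHodgeType n X n 0 n (a • x₀) := by
    have h : a • x₀ = -(b • conjClass (ComplexPoints X) n x₀) := eq_neg_of_add_eq_zero_left hab
    rw [h]
    exact (hc₀.smul b).neg
  have haz : a • x₀ = 0 := ha.eq_zero_of_ne hX ha' (by simp only [ne_eq, Prod.mk.injEq]; omega)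
  have ha0 : a = 0 := by
    rcases smul_eq_zero.1 haz with h | h
    · exact h
    · exact absurd h hx₀0
  rw [ha0, zero_smul, zero_add] at hab
  have hb0 : b = 0 := by
    rcases smul_eq_zero.1 hab with h | h
    · exact h
    · exact absurd h (conjClass_ne_zero hx₀0)
  exact ⟨ha0, hb0⟩

/-- **Every class is `a x₀ + b conj x₀`** when `dim Hⁿ(X(ℂ); ℂ) = 2` and `x₀ ≠ 0` is of type `(n, 0)`.
[cite: VoisinHodgeI2002, Cor. 6.12 and Cor. 6.14] -/
theorem exists_eq_smul_add_smul_conjClass (hX : IsSmoothProjective n X) (hn : 0 < n)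
    (hfin : Module.finrank ℂ (complexBetti X n) = 2) {x₀ : complexBetti X n} (hx₀0 : x₀ ≠ 0)
    (hx₀ : IsOfHodgeType n X n n 0 x₀) (x : complexBetti X n) :
    ∃ a b : ℂ, x = a • x₀ + b • conjClass (ComplexPoints X) n x₀ := by
  have hli := linearIndependent_pair_conjClass hX hn hx₀0 hx₀
  haveI := finite_complexBetti_of_isSmoothProjective hX n
  have hspan : Submodule.span ℂ (Set.range ![x₀, conjClass (ComplexPoints X) n x₀]) = ⊤ :=
    hli.span_eq_top_of_card_eq_finrank (by rw [hfin]; simp)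
  have hx : x ∈ Submodule.span ℂ (Set.range ![x₀, conjClass (ComplexPoints X) n x₀]) := by rw [hspan]; trivial
  rw [Submodule.mem_span_range_iff_exists_fun] at hx
  obtain ⟨c, rfl⟩ := hx
  exact ⟨c 0, c 1, by simp [Fin.sum_univ_two]⟩

/-- **A class of type `(n, 0)` is a multiple of `x₀`** (same hypotheses): in `y = a x₀ + b conj x₀` the term `b conj x₀` is
of type `(n,0)` and of type `(0,n)`, hence zero. [cite: VoisinHodgeI2002, Cor. 6.14] -/
theorem exists_eq_smul_of_isOfHodgeType_n_zero (hX : IsSmoothProjective n X) (hn : 0 < n)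
    (hfin : Module.finrank ℂ (complexBetti X n) = 2) {x₀ : complexBetti X n} (hx₀0 : x₀ ≠ 0)
    (hx₀ : IsOfHodgeType n X n n 0 x₀) {y : complexBetti X n} (hy : IsOfHodgeType n X n n 0 y) :
    ∃ a : ℂ, y = a • x₀ := by
  obtain ⟨a, b, hab⟩ := exists_eq_smul_add_smul_conjClass hX hn hfin hx₀0 hx₀ y
  have hb : IsOfHodgeType n X n n 0 (b • conjClass (ComplexPoints X) n x₀) := by
    have h : b • conjClass (ComplexPoints X) n x₀ = y - a • x₀ := by rw [hab]; abel
    rw [h]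
    exact hy.sub hX (hx₀.smul a)
  have hb' : IsOfHodgeType n X n 0 n (b • conjClass (ComplexPoints X) n x₀) := (hx₀.conjClass hX).smul b
  have hbz : b • conjClass (ComplexPoints X) n x₀ = 0 :=
    hb.eq_zero_of_ne hX hb' (by simp only [ne_eq, Prod.mk.injEq]; omega)
  exact ⟨a, by rw [hab, hbz, add_zero]⟩

/-! ## §2 A rational linear map commutes with conjugation; the bijectivity theorem -/

/-- **A `ℂ`-linear map carrying rational classes to rational classes commutes with complex conjugation** (rational classes
are real and span `H•(X(ℂ); ℂ)` for `X` smooth projective). [cite: VoisinHodgeI2002, Cor. 6.12 and §7.1.1] -/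
theorem conjClass_linearMap_apply (hX : IsSmoothProjective n X) {k k' : ℕ} {X' : SchemeOver ℂ}
    (Φ : complexBetti X k →ₗ[ℂ] complexBetti X' k') (hΦ : ∀ x, IsRationalClass x → IsRationalClass (Φ x))
    (x : complexBetti X k) :
    conjClass (ComplexPoints X') k' (Φ x) = Φ (conjClass (ComplexPoints X) k x) := by
  have hx : x ∈ Submodule.span ℂ {c : complexBetti X k | IsRationalClass c} := by
    rw [span_isRationalClass_eq_top_of_isSmoothProjective_holds n X hX k]; trivial
  induction hx using Submodule.span_induction with
  | mem c hc => rw [hc.conjClass_eq, (hΦ c hc).conjClass_eq]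
  | zero => rw [conjClass_zero, map_zero, conjClass_zero]
  | add x y _ _ hx hy => rw [map_add, conjClass_add, hx, hy, conjClass_add, map_add]
  | smul t x _ hx => rw [map_smul, conjClass_smul, hx, conjClass_smul, map_smul]

/-- **A non-zero rational, `(n,0)`-type-preserving linear map between rigid-type `Hⁿ`'s is bijective** (`X`, `X'` smooth
projective of dimension `n ≥ 1`, `dim Hⁿ = 2` with a non-zero `(n,0)`-class on both sides): `Φ x₀ = a x₀'`,
`Φ (conj x₀) = conj(a) conj x₀'`, `a ≠ 0`. [cite: VoisinHodgeI2002, §7.1.1 and Cor. 6.14] [cite: GouveaYui2011, §1] -/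
theorem bijective_of_isHodgeHom_of_ne_zero (hX : IsSmoothProjective n X) (hX' : IsSmoothProjective n X') (hn : 0 < n)
    (hfin : Module.finrank ℂ (complexBetti X n) = 2) (hx₀ : ∃ x : complexBetti X n, x ≠ 0 ∧ IsOfHodgeType n X n n 0 x)
    (hfin' : Module.finrank ℂ (complexBetti X' n) = 2)
    (hx₀' : ∃ x : complexBetti X' n, x ≠ 0 ∧ IsOfHodgeType n X' n n 0 x)
    (Φ : complexBetti X n →ₗ[ℂ] complexBetti X' n) (hrat : ∀ x, IsRationalClass x → IsRationalClass (Φ x))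
    (htyp : ∀ x : complexBetti X n, IsOfHodgeType n X n n 0 x → IsOfHodgeType n X' n n 0 (Φ x)) (hne : Φ ≠ 0) :
    Function.Bijective Φ := by
  obtain ⟨x₀, hx₀0, hx₀T⟩ := hx₀
  obtain ⟨x₀', hx₀'0, hx₀'T⟩ := hx₀'
  -- `Φ x₀ = a x₀'`, `Φ (conj x₀) = conj a • conj x₀'`
  obtain ⟨a, ha⟩ := exists_eq_smul_of_isOfHodgeType_n_zero hX' hn hfin' hx₀'0 hx₀'T (htyp x₀ hx₀T)
  have hac : Φ (conjClass (ComplexPoints X) n x₀) = starRingEnd ℂ a • conjClass (ComplexPoints X') n x₀' := by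
    rw [← conjClass_linearMap_apply hX Φ hrat x₀, ha, conjClass_smul]
  -- `a ≠ 0`
  have ha0 : a ≠ 0 := by
    intro h0
    apply hne
    refine LinearMap.ext fun x ↦ ?_
    obtain ⟨c₀, c₁, rfl⟩ := exists_eq_smul_add_smul_conjClass hX hn hfin hx₀0 hx₀T x
    rw [map_add, map_smul, map_smul, ha, hac, h0, map_zero, zero_smul, zero_smul, smul_zero, smul_zero, add_zero,
      LinearMap.zero_apply]
  -- injective
  have hli' := linearIndependent_pair_conjClass hX' hn hx₀'0 hx₀'T
  have hinj : Function.Injective Φ := by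
    rw [injective_iff_map_eq_zero]
    intro x hx
    obtain ⟨c₀, c₁, rfl⟩ := exists_eq_smul_add_smul_conjClass hX hn hfin hx₀0 hx₀T x
    rw [map_add, map_smul, map_smul, ha, hac, smul_smul, smul_smul] at hx
    obtain ⟨h₀, h₁⟩ := LinearIndependent.pair_iff.1 hli' _ _ hx
    have hc₀ : c₀ = 0 := by simpa [ha0] using h₀
    have hc₁ : c₁ = 0 := by simpa [ha0] using h₁
    rw [hc₀, hc₁, zero_smul, zero_smul, add_zero]
  -- surjective by equality of dimensions
  haveI := finite_complexBetti_of_isSmoothProjective hX n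
  haveI := finite_complexBetti_of_isSmoothProjective hX' n
  exact ⟨hinj, (LinearMap.injective_iff_surjective_of_finrank_eq_finrank (hfin.trans hfin'.symm)).1 hinj⟩

/-! ## §3 The stub, in the registered spelling -/

/-- `cx Y₀ = Y₀ ⊗_ℚ ℂ` — the crux's `let cx`. -/
local notation3 "cx " Y₀:max => (baseChange ℚ ℂ).obj Y₀

/-- `Rigid Y₀` — the crux's `let Rigid`. -/
local notation3 "Rigid " Y₀:max => (IsSmoothProjective 3 Y₀ ∧ Module.finrank ℂ (complexBetti (cx Y₀) 3) = 2 ∧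
    ∃ x : complexBetti (cx Y₀) 3, x ≠ 0 ∧ IsOfHodgeType 3 (cx Y₀) 3 3 0 x)

/-- `IsHodgeHom Y Y' Ψ` — the crux's `HodgeHom`: rational classes to rational classes, `(p,q)`-classes to `(p,q)`-classes. -/
local notation3 "IsHodgeHom " Y:max Y':max Ψ:max =>
  ((∀ x, IsRationalClass x → IsRationalClass ((Ψ : complexBetti Y 3 →ₗ[ℂ] complexBetti Y' 3) x)) ∧
    ∀ (p q : ℕ) (x : complexBetti Y 3), IsOfHodgeType 3 Y 3 p q x →
      IsOfHodgeType 3 Y' 3 p q ((Ψ : complexBetti Y 3 →ₗ[ℂ] complexBetti Y' 3) x))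

/-- `GalIso Y₀ Y₀'` — the crux's `let GalIso`. -/
local notation3 "GalIso " Y₀:max Y₀':max => (∃ (ℓ : ℕ) (_ : Fact ℓ.Prime) (U : OpenSubgroup (Field.absoluteGaloisGroup ℚ))
    (e : ellAdicEtaleCohomologyRat ℓ 3 (geometricFibre ℚ Y₀) ≃ₗ[ℚ_[ℓ]] ellAdicEtaleCohomologyRat ℓ 3 (geometricFibre ℚ Y₀')),
    ∀ g ∈ U, e.toLinearMap ∘ₗ geometricEllAdicEtaleCohomologyRepRat ℓ Y₀ 3 g =
      geometricEllAdicEtaleCohomologyRepRat ℓ Y₀' 3 g ∘ₗ e.toLinearMap)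

/-- `IsMotivatedCorrespondence m n W X T` — the line's notion: `T = γ^*` for a MOTIVATED class `γ ∈ A_motᵉ((W ⊗ X)(ℂ))_ℂ`
(André 1996 §2.1 `C_mot(X, W)`), for some Poincaré-duality orientations. -/
local notation3 "IsMotivatedCorrespondence " m:max n:max W:max X:max T:max =>
  (∃ (μ : HomologicalOrientation ℂ (ComplexPoints (W ⊗ X)) (2 * (m + n)))
    (ν : HomologicalOrientation ℂ (ComplexPoints W) (2 * m))
    (_ : μ.HasPoincareDuality) (_ : ν.HasPoincareDuality) (e q : ℕ) (hab : 3 + 2 * e = 3 + 2 * n)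
    (hq : 3 + q = 2 * m) (γ : complexBetti (W ⊗ X) (2 * e)),
    γ ∈ motivatedClasses (m + n) (W ⊗ X) e ∧ corrClassAction μ ν hab hq γ = T)

/-- **The crux is literally the statement over these carriers** (`Iff.rfl`). [folklore] -/
theorem hodgeIsoForcesRelatives_iff :
    Summit.HodgeConjecture.HodgeConjecture.Theses.RigidRelativesJacobianTorelli.HodgeIsoForcesRelatives ↔
      ∀ ⦃X₀ X₀' : SchemeOver.{0} ℚ⦄, Rigid X₀ → Rigid X₀' →
        ∀ Φ : complexBetti (cx X₀) 3 →ₗ[ℂ] complexBetti (cx X₀') 3,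
          IsHodgeHom (cx X₀) (cx X₀') Φ → Φ ≠ 0 → GalIso X₀ X₀' :=
  Iff.rfl

/-- **Stub `stub_nonzeroHodgeHomBijective` of crux `HodgeIsoForcesRelatives` (registered signature, verbatim in the skeleton's
spelling): a non-zero Hodge homomorphism between the `H³`'s of rigid-type threefolds is bijective.**
[cite: VoisinHodgeI2002, §7.1.1 and Cor. 6.14] [cite: GouveaYui2011, §1] -/
theorem stub_nonzeroHodgeHomBijective :
    ∀ ⦃X₀ X₀' : SchemeOver.{0} ℚ⦄, Rigid X₀ → Rigid X₀' →
      ∀ Φ : complexBetti (cx X₀) 3 →ₗ[ℂ] complexBetti (cx X₀') 3,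
        IsHodgeHom (cx X₀) (cx X₀') Φ → Φ ≠ 0 → Function.Bijective Φ :=
  fun _ _ hR hR' Φ hΦ hne ↦
    bijective_of_isHodgeHom_of_ne_zero (IsSmoothProjective.baseChange_holds (k := ℚ) ℂ hR.1)
      (IsSmoothProjective.baseChange_holds (k := ℚ) ℂ hR'.1) (by norm_num) hR.2.1 hR.2.2 hR'.2.1 hR'.2.2 Φ hΦ.1
      (fun x hx ↦ hΦ.2 3 0 x hx) hne

/-! ## §4 The composition, with stub 1 discharged -/

/-- **`HodgeIsoForcesRelatives` from the two remaining stubs** (the skeleton's `HodgeIsoForcesRelatives_of` with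
`stub_nonzeroHodgeHomBijective` plugged in): if Hodge homomorphisms between rigid-type `H³`'s are MOTIVATED correspondences
(S₂, open) and bijective motivated correspondences preserving rational classes are Galois-compatible on an open subgroup
(S₃, André 1996 §2.5 a) Scolie + Prop. 2.5.1, XL), then a non-zero Hodge hom of rigid-type threefolds forces relatives.
[cite: Andre1996Motifs, §2.1 and §2.5] [cite: Deligne1982HodgeCycles, §2] -/
theorem hodgeIsoForcesRelatives_of_hodgeHomMotivated_of_motivatedGalois
    (h₂ : ∀ ⦃X₀ X₀' : SchemeOver.{0} ℚ⦄, Rigid X₀ → Rigid X₀' →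
      ∀ Φ : complexBetti (cx X₀) 3 →ₗ[ℂ] complexBetti (cx X₀') 3,
        IsHodgeHom (cx X₀) (cx X₀') Φ → IsMotivatedCorrespondence 3 3 (cx X₀') (cx X₀) Φ)
    (h₃ : ∀ ⦃X₀ X₀' : SchemeOver.{0} ℚ⦄, IsSmoothProjective 3 X₀ → IsSmoothProjective 3 X₀' →
      ∀ Φ : complexBetti (cx X₀) 3 →ₗ[ℂ] complexBetti (cx X₀') 3,
        (∀ x, IsRationalClass x → IsRationalClass (Φ x)) →
          IsMotivatedCorrespondence 3 3 (cx X₀') (cx X₀) Φ → Function.Bijective Φ →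
            GalIso X₀ X₀') :
    Summit.HodgeConjecture.HodgeConjecture.Theses.RigidRelativesJacobianTorelli.HodgeIsoForcesRelatives :=
  hodgeIsoForcesRelatives_iff.2 fun _ _ hX hX' Φ hΦ hne ↦
    h₃ hX.1 hX'.1 Φ hΦ.1 (h₂ hX hX' Φ hΦ) (stub_nonzeroHodgeHomBijective hX hX' Φ hΦ hne)

end Summit.HodgeConjecture.HodgeConjecture.Theorems.HodgeIsoForcesRelatives

end
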